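import Literature.NumberTheory.EllipticCurves.NewformsHeckeProofs
import Literature.NumberTheory.EllipticCurves.NewformsProofs
import Literature.NumberTheory.EllipticCurves.ModularCurveSturmProofs
import HarnessLib

/-!
# Level raising and strong multiplicity one on `Γ₀(N)`: degeneracy maps `ι_d`, the sieve `K_p`,
# the vanishing of `p`-supported forms, and the reduction of `IsNewform0.eq_of_heckeEigenvalue_eq`
# to the Atkin–Lehner Main Lemma (trunk EllArithM; `Newforms.lean`, `HeckeOperators.lean` continued)

`Newforms.lean` states as a named fact (D-0014)
`IsNewform0.eq_of_heckeEigenvalue_eq : ∀ f g newforms in S_k(Γ₀(N)), {p : λ_f(p) ≠ λ_g(p)} finite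
→ f = g` (**strong multiplicity one**, Atkin–Lehner 1970, Thm. 4, same-level case; Diamond–Shurman
p. 199: "We do not prove Strong Multiplicity One"; Rankin 1977, p. 237: "has been shown by Atkin
and Lehner"). This file proves it **conditionally on two named facts** of Atkin–Lehner theory
(`IsNewform0.eq_of_heckeEigenvalue_eq_of_facts`):

* (ML) `atkinLehnerMainLemma0 N k` — **Atkin–Lehner's Main Lemma** (Atkin–Lehner 1970, Thm. 1;
  Diamond–Shurman Thm. 5.7.1 prints the `Γ₁(N)` version): `a_n(f) = 0` for all `(n, N) = 1` forces
  `f ∈ Σ_{p ∣ N} ι_p S_k(Γ₀(N/p))` — vendored here as a named fact;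
* (D) `disjoint_oldSubspace0_newSubspace0 N k` (`Newforms.lean`; Atkin–Lehner 1970, Thm. 5):
  `S_k(Γ₀(N))^{old} ∩ S_k(Γ₀(N))^{new} = 0` for the kernel-defined new subspace (Petersson theory),

everything else being proved: the `q`-expansion of `T_p` is `qExpansion_coeff_heckeT_holds`
(`HeckeOperatorsProofs`, Diamond–Shurman Prop. 5.2.2(a)), and the third classical input, the
**vanishing of forms supported on the multiples of a prime `p ∤ N`**
(`eq_zero_of_coeff_eq_zero_of_not_dvd_level0`, stated as a named fact for the DAG and *discharged*
here, `eq_zero_of_coeff_eq_zero_of_not_dvd_level0_holds`), is proved below by level raising and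
Sturm's bound.

## Main definitions (namespace `Literature.ModularForms`)

* `cuspFormOfLE h f`, `cuspFormOfLEₗ h k`: a cusp form of level `Γ` regarded as one of a smaller
  level `Γ' ≤ Γ` (same function; Mathlib `IsCusp.mono`); `toLevel0 (h : M ∣ N) k`, the inclusion
  `S_k(Γ₀(M)) → S_k(Γ₀(N))` (Diamond–Shurman Exercise 5.6.1) — the definitional (`coe = rfl`)
  version of the trunk's `restrictLevel`, equal to it by `toLevel0_eq_restrictLevel`.
* `iota M N d k h : S_k(Γ₀(M)) →ₗ[ℂ] S_k(Γ₀(N))` for `h : M * d ∣ N`: the **degeneracy map**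
  `ι_d = d^{1-k}[diag(d,1)]_k`, `(ι_d f)(τ) = f(dτ)` (Diamond–Shurman §5.7; Atkin–Lehner's `B_d`),
  built from Mathlib's `CuspForm.translate` by `tpD d = diag(d,1)` (`HeckeOperatorsProofs`) and the
  inclusion `Γ₀(N) ⊆ diag(d,1)⁻¹Γ₀(M)diag(d,1)` (`gamma0GL_le_conj`); `iota_apply`,
  `coe_iota_apply`, `iota_injective`, `qExpansion_coeff_iota` (`a_n(ι_d f) = 𝟙_{d∣n} a_{n/d}(f)`).
* `uOp M k p : S_k(Γ₀(M)) → S_k(Γ₀(Mp))`, `U_p = T_p - 𝟙_{p∤M} p^{k-1} ι_p`, `a_n(U_p f) = a_{pn}(f)`;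
  `sieveOp M k p : S_k(Γ₀(M)) → S_k(Γ₀(Mp²))`, `K_p = 1 - ι_p U_p`, `a_n(K_p f) = 𝟙_{p∤n} a_n(f)`
  (Atkin–Lehner's `f - f∣U_p∣B_p`; `qExpansion_coeff_uOp`, `qExpansion_coeff_sieveOp`).
* `divLevelRaise hp f hsupp`, `mulLevelRaise hp f hsupp ∈ S_k(Γ₀(N))`: for `f ∈ S_k(Γ₀(N))` with
  `a_n(f) = 0` for all `p ∤ n`, the cusp forms `f(τ/p) = p (f ∣[k] diag(1,p))(τ)` and (for
  `p ∤ N`) `f(pτ) = p^{1-k}(T_p f - f(·/p))(τ)` of the **same** level.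
* Named facts `atkinLehnerMainLemma0 N k`, `eq_zero_of_coeff_eq_zero_of_not_dvd_level0 N k`.

## Main results

* `coe_degeneracyMap0`, `degeneracyMap0_eq_smul_iota`, `range_iota_le_oldSubspace0`: the Hecke
  correspondence `degeneracyMap0 M N d k = [Γ₀(M) diag(d,1) Γ₀(N)]` of `Newforms.lean` is the
  single term `d^{k-1} ι_d` when `M d ∣ N` (the trace runs over a one-point quotient), so
  `ι_d(S_k(Γ₀(M))) ⊆ S_k(Γ₀(N))^{old}`; `atkinLehnerMainLemma0.mem_oldSubspace0`.
* `eq_zero_of_coeff_eq_zero_of_not_dvd_level0_holds` (**level raising**, proved): if `p ∤ N` is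
  prime and `f ∈ S_k(Γ₀(N))` has `a_n(f) = 0` for all `p ∤ n`, then `f = 0`. Architecture:
  1. `smul_slash_tpG_eq_sum_slash_tpB`: `p (f ∣ diag(1,p)) = ∑_{j mod p} f ∣ (1 j; 0 p)` — both are
     `∑ a_{pn} qⁿ` (`hasSum_sum_slash_tpB` of `HeckeOperatorsProofs`, orthogonality of characters,
     and the support hypothesis);
  2. the right side is `T`-invariant (`sum_slash_tpB_slash_T`: `(1 j;0 p)T = (1 j+1; 0 p)`,
     `(1 p; 0 p) = T diag(1,p)`), the left side is invariant under `Γ₀(N) ∩ Γ⁰(p)`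
     (`slash_tpG_slash_mapGL_of_dvd`: `diag(1,p)(a b; c d) = (a b/p; pc d)diag(1,p)`), and
     `Γ₀(N) = ⟨T⟩ (Γ₀(N) ∩ Γ⁰(p)) ⟨T⟩` (`exists_eq_T_zpow_mul_mul_T_zpow`: `γT^j` if `p ∤ a`, else
     `Tγ T^j`, as `p ∣ a, p ∣ c` is impossible); hence `f(τ/p) ∈ S_k(Γ₀(N))` (`divLevelRaise`,
     cusp conditions from `CuspForm.translate`);
  3. `T_p f = ∑ⱼ f∣(1 j;0 p) + f∣diag(p,1)` for `p ∤ N` (`coe_heckeT_gamma0_eq_sum`, Diamond–Shurman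
     Prop. 5.2.1) gives `f(pτ) ∈ S_k(Γ₀(N))` (`mulLevelRaise`), with `a_n = 𝟙_{p∣n} a_{n/p}(f)`;
  4. iterating, `f(p^r τ) ∈ S_k(Γ₀(N))` has `a_n = 0` for `n < p^r`; beyond the cuspidal Sturm
     bound (`cuspForm_eq_zero_of_qExpansion_coeff_eq_zero`, `ModularCurveSturmProofs`; Sturm 1987,
     Thm. 1) it vanishes, so every `a_n(f)` does.
  (This is the mechanism of Hecke's argument in Rankin 1977, Thm. 8.3.4, and of the level-`p`
  operators `B_p` in Atkin–Lehner 1970; we record it as [folklore].)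
* `qExpansion_coeff_eq_of_heckeEigenvalue_eq` (**coefficients from eigenvalues**): normalised
  eigenforms of all `T_p` with the same eigenvalues outside a finite set `S` have the same `a_n`
  for every `n ≥ 1` free of `S` (Hecke recursion `heckeEigenvalue_mul_coeff`,
  Diamond–Shurman Prop. 5.8.5, by strong induction on `n`).
* `eq_zero_of_coeff_eq_zero_off_primes`, `coeff_eq_zero_off_primes_of_coeff_eq_zero_off_more_primes`
  (**sieve and peel**): sieving out the primes of the level with `K_p` and peeling off the other
  exceptional primes with the vanishing lemma, a form whose coefficients vanish off a finite set of
  primes has `a_n = 0` for all `n` prime to the level (cf. Rankin 1977, proof of Thm. 9.4.5).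
* `IsNewform0.eq_of_heckeEigenvalue_eq_of_facts (hML) (hD) : IsNewform0.eq_of_heckeEigenvalue_eq`:
  for newforms `f, g`, `h = f - g` has `a_n(h) = 0` for all `(n, N) = 1` by the above, so `h` is old
  by (ML) and new (a submodule), hence `0` by (D). Once (ML) and (D) are discharged the fact
  `IsNewform0.eq_of_heckeEigenvalue_eq_holds` is the corresponding one-liner.

## References

* A. O. L. Atkin, J. Lehner, *Hecke operators on `Γ₀(m)`*, Math. Ann. 185 (1970), 134–160,
  Thms. 1, 4, 5.
* F. Diamond, J. Shurman, *A first course in modular forms*, GTM 228, 2005: §5.2 (Prop. 5.2.1,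
  5.2.2), §5.6 (Def. 5.6.1, Exercise 5.6.1), §5.7 (`ι_d`, Thm. 5.7.1), §5.8 (Thm. 5.8.2,
  Prop. 5.8.5; p. 199 on Strong Multiplicity One).
* R. A. Rankin, *Modular forms and functions*, CUP 1977, Thm. 8.3.4, §9.4 (Thm. 9.4.5), pp. 236–237
  ("theorem 1 of Atkin and Lehner (1970)"; strong multiplicity one "shown by Atkin and Lehner").
* J. Sturm, *On the congruence of modular forms*, LNM 1240 (1987), Thm. 1.
-/

noncomputable section

open scoped MatrixGroups ModularForm

open CongruenceSubgroup UpperHalfPlane ConjAct Pointwise ModularGroup Matrix.SpecialLinearGroup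

namespace Literature.NumberTheory.EllipticCurves.ModularForms

/-! ### Change of level along an inclusion `Γ' ≤ Γ` -/

section LevelChange

variable {Γ Γ' : Subgroup (GL (Fin 2) ℝ)} {k : ℤ}

/-- A cusp form of level `Γ` is a cusp form of every smaller level `Γ' ≤ Γ` (same function on `ℍ`;
every cusp of `Γ'` is a cusp of `Γ`, Mathlib `IsCusp.mono`) (Diamond–Shurman §5.6:
`S_k(Γ₁(M)) ⊆ S_k(Γ₁(N))` for `M ∣ N`, Exercise 5.6.1). [folklore] -/
def cuspFormOfLE (h : Γ' ≤ Γ) (f : CuspForm Γ k) : CuspForm Γ' k where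
  toFun := f
  slash_action_eq' γ hγ := SlashInvariantFormClass.slash_action_eq f γ (h hγ)
  holo' := f.holo'
  zero_at_cusps' hc := f.zero_at_cusps' (hc.mono h)

/-- `cuspFormOfLE` does not change the function. [folklore] -/
@[simp] lemma coe_cuspFormOfLE (h : Γ' ≤ Γ) (f : CuspForm Γ k) :
    (⇑(cuspFormOfLE h f) : ℍ → ℂ) = ⇑f := rfl

variable [Γ.HasDetOne] [Γ'.HasDetOne]

/-- `cuspFormOfLE` as a `ℂ`-linear map (levels contained in `SL(2, ℝ)`, where Mathlib's
`ℂ`-module structure on cusp forms is available). This is the *definitional* version (`coe = rfl`,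
no arithmeticity needed) of the trunk's level-change map `restrictLevel Γ Γ' k = [Γ 1 Γ']`
(`HeckeOperators.lean`), to which it is equal for arithmetic levels by `restrictLevel_apply_coe_holds`
(`NewformsProofs.lean`); see `toLevel0_eq_restrictLevel`. [folklore] -/
def cuspFormOfLEₗ (h : Γ' ≤ Γ) (k : ℤ) : CuspForm Γ k →ₗ[ℂ] CuspForm Γ' k where
  toFun := cuspFormOfLE h
  map_add' f g := by ext; rfl
  map_smul' c f := by ext; rfl

/-- `cuspFormOfLEₗ` does not change the function. [folklore] -/
@[simp] lemma coe_cuspFormOfLEₗ (h : Γ' ≤ Γ) (f : CuspForm Γ k) :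
    (⇑(cuspFormOfLEₗ h k f) : ℍ → ℂ) = ⇑f := rfl

/-- Change of level along `Γ' ≤ Γ` is injective. [folklore] -/
lemma cuspFormOfLEₗ_injective (h : Γ' ≤ Γ) : Function.Injective (cuspFormOfLEₗ h k) := by
  intro f g hfg
  ext τ
  simpa using congrArg (fun F : CuspForm Γ' k ↦ F τ) hfg

end LevelChange

section Gamma0Level

/-- `Γ₀(N) ≤ Γ₀(M)` for `M ∣ N`, as subgroups of `GL(2, ℝ)` (the `SL(2, ℤ)`-level inclusion is
`gamma0_le_gamma0_of_dvd` of `ModularCurveGenusTwoProofs`, not imported here). [folklore] -/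
lemma Gamma0GL_le_of_dvd {M N : ℕ} (h : M ∣ N) :
    ((Gamma0 N : Subgroup SL(2, ℤ)) : Subgroup (GL (Fin 2) ℝ)) ≤
      ((Gamma0 M : Subgroup SL(2, ℤ)) : Subgroup (GL (Fin 2) ℝ)) := by
  refine Subgroup.map_mono fun γ hγ ↦ ?_
  rw [Gamma0_mem] at hγ ⊢
  rw [ZMod.intCast_zmod_eq_zero_iff_dvd] at hγ ⊢
  exact (Int.natCast_dvd_natCast.mpr h).trans hγ

/-- Change of level `S_k(Γ₀(M)) → S_k(Γ₀(N))` for `M ∣ N`: the inclusion (same function on `ℍ`)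
(Diamond–Shurman §5.6, Exercise 5.6.1). Definitional version of `restrictLevel (Gamma0 M) (Gamma0 N) k`
of `HeckeOperators.lean` (equal to it, `toLevel0_eq_restrictLevel`). [folklore] -/
def toLevel0 {M N : ℕ} (h : M ∣ N) (k : ℤ) :
    CuspForm (Gamma0 M) k →ₗ[ℂ] CuspForm (Gamma0 N) k :=
  cuspFormOfLEₗ (Gamma0GL_le_of_dvd h) k

/-- `toLevel0` does not change the function. [folklore] -/
@[simp] lemma coe_toLevel0 {M N : ℕ} (h : M ∣ N) (k : ℤ) (f : CuspForm (Gamma0 M) k) :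
    (⇑(toLevel0 h k f) : ℍ → ℂ) = ⇑f := rfl

/-- `toLevel0` **is** the trunk's level-change map `restrictLevel (Gamma0 M) (Gamma0 N) k = [Γ₀(M) 1 Γ₀(N)]`
(`HeckeOperators.lean`; its underlying function is unchanged, `restrictLevel_apply_coe_holds` of
`NewformsProofs.lean`), so the two inclusions do not diverge. [folklore] -/
lemma toLevel0_eq_restrictLevel {M N : ℕ} [NeZero M] [NeZero N] (h : M ∣ N) (k : ℤ)
    (f : CuspForm (Gamma0 M) k) :
    toLevel0 h k f = restrictLevel (Gamma0 M) (Gamma0 N) k f :=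
  DFunLike.ext' (by rw [coe_toLevel0, restrictLevel_apply_coe_holds _ _ k (Gamma0GL_le_of_dvd h) f])

/-- The (period-`1`) `q`-expansion is unchanged by `toLevel0` (same function). [folklore] -/
@[simp] lemma qExpansion_toLevel0 {M N : ℕ} (h : M ∣ N) (k : ℤ) (f : CuspForm (Gamma0 M) k) :
    qExpansion 1 ⇑(toLevel0 h k f) = qExpansion 1 ⇑f := rfl

end Gamma0Level

/-! ### `q`-expansions: a packaged `hasSum` -/

/-- The `q`-expansion of a modular form sums to it (Mathlib's `hasSum_qExpansion`, packaged for a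
`ModularFormClass` whose level contains the translation by `h`). [folklore] -/
lemma hasSum_qExpansion_of_mem_strictPeriods {F : Type*} [FunLike F ℍ ℂ]
    {Γ : Subgroup (GL (Fin 2) ℝ)} {k : ℤ} [ModularFormClass F Γ k] {h : ℝ} (hh : 0 < h)
    (hΓ : h ∈ Γ.strictPeriods) (f : F) (τ : ℍ) :
    HasSum (fun m : ℕ ↦ (qExpansion h ⇑f).coeff m • Function.Periodic.qParam h τ ^ m) (f τ) :=
  haveI : Fact (IsCusp OnePoint.infty Γ) := ⟨Γ.isCusp_of_mem_strictPeriods hh hΓ⟩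
  hasSum_qExpansion hh (SlashInvariantFormClass.periodic_comp_ofComplex f hΓ)
    (ModularFormClass.holo f) (ModularFormClass.bdd_at_infty f) τ

/-- A modular form all of whose `q`-expansion coefficients vanish is zero (Mathlib
`qExpansion_eq_zero_iff`, packaged). [folklore] -/
lemma coe_eq_zero_of_qExpansion_eq_zero {F : Type*} [FunLike F ℍ ℂ]
    {Γ : Subgroup (GL (Fin 2) ℝ)} {k : ℤ} [ModularFormClass F Γ k] {h : ℝ} (hh : 0 < h)
    (hΓ : h ∈ Γ.strictPeriods) (f : F) (hf : qExpansion h ⇑f = 0) : (⇑f : ℍ → ℂ) = 0 :=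
  haveI : Fact (IsCusp OnePoint.infty Γ) := ⟨Γ.isCusp_of_mem_strictPeriods hh hΓ⟩
  (qExpansion_eq_zero_iff hh (SlashInvariantFormClass.periodic_comp_ofComplex f hΓ)
    (ModularFormClass.holo f) (ModularFormClass.bdd_at_infty f)).mp hf

/-- `𝕢₁(dτ) = 𝕢₁(τ)^d` for `d ∈ ℕ`. [folklore] -/
lemma qParam_one_natMul (d : ℕ) (τ : ℍ) :
    Function.Periodic.qParam 1 ((d : ℂ) * τ) = Function.Periodic.qParam 1 τ ^ d := by
  simp only [Function.Periodic.qParam, Complex.ofReal_one, div_one, ← Complex.exp_nat_mul]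
  ring_nf

/-! ### The degeneracy map `ι_d` (the matrix `tpD d = diag(d, 1)` of `HeckeOperatorsProofs`) -/

section Iota

/-- Conjugation: for `γ ∈ Γ₀(N)` and `M d ∣ N`, `diag(d,1) γ = γ' diag(d,1)` with
`γ' = (a, db; c/d, e) ∈ Γ₀(M)` (Diamond–Shurman §5.6 / Exercise 1.2.11: `[α_d]_k` maps level `M`
to level `N`). [folklore] -/
lemma exists_tpD_mul_eq {M N d : ℕ} [NeZero d] (h : M * d ∣ N) {γ : SL(2, ℤ)}
    (hγ : γ ∈ Gamma0 N) :
    ∃ γ' ∈ Gamma0 M, tpD d * Matrix.SpecialLinearGroup.mapGL ℝ γ =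
      Matrix.SpecialLinearGroup.mapGL ℝ γ' * tpD d := by
  have hc : ((N : ℤ)) ∣ γ 1 0 := by
    rw [Gamma0_mem] at hγ
    exact (ZMod.intCast_zmod_eq_zero_iff_dvd _ _).mp hγ
  obtain ⟨t, ht⟩ := hc
  obtain ⟨s, hs⟩ := h
  let A : Matrix (Fin 2) (Fin 2) ℤ := !![γ 0 0, d * γ 0 1; M * s * t, γ 1 1]
  have h10 : γ 1 0 = d * (M * s * t) := by rw [ht, hs]; push_cast; ring
  have hdet : A.det = 1 := by
    have h1 : γ 0 0 * γ 1 1 - γ 0 1 * γ 1 0 = 1 := by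
      have := Matrix.det_fin_two γ.1
      rw [γ.2] at this
      linarith
    rw [Matrix.det_fin_two_of]
    rw [h10] at h1
    linear_combination h1
  refine ⟨⟨A, hdet⟩, ?_, ?_⟩
  · simp [Gamma0_mem, A]
  · ext i j
    simp only [Units.val_mul, Matrix.SpecialLinearGroup.mapGL_coe_matrix, val_tpD]
    have : (γ 1 0 : ℝ) = d * (M * s * t) := by exact_mod_cast h10
    fin_cases i <;> fin_cases j <;>
      simp [Matrix.mul_apply, Fin.sum_univ_two, A, this] <;> ring

/-- `Γ₀(N) ⊆ diag(d,1)⁻¹ Γ₀(M) diag(d,1)` for `M d ∣ N` (as subgroups of `GL(2, ℝ)`): the level of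
`f ∣[k] diag(d,1)` for `f` of level `Γ₀(M)` contains `Γ₀(N)` (Diamond–Shurman Exercise 1.2.11). [folklore] -/
lemma gamma0GL_le_conj {M N d : ℕ} [NeZero d] (h : M * d ∣ N) :
    ((Gamma0 N : Subgroup SL(2, ℤ)) : Subgroup (GL (Fin 2) ℝ)) ≤
      toConjAct (tpD d)⁻¹ • ((Gamma0 M : Subgroup SL(2, ℤ)) : Subgroup (GL (Fin 2) ℝ)) := by
  rintro x ⟨γ, hγ, rfl⟩
  rw [toConjAct_inv, Subgroup.mem_inv_pointwise_smul_iff, ConjAct.smul_def,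
    ConjAct.ofConjAct_toConjAct]
  obtain ⟨γ', hγ', hγ'eq⟩ := exists_tpD_mul_eq h hγ
  refine ⟨γ', hγ', ?_⟩
  rw [hγ'eq, mul_inv_cancel_right]

variable (M N d : ℕ) [NeZero d] (k : ℤ)

variable (h : M * d ∣ N)

/-- The underlying map of `ι_d`: `f ↦ d^{1-k} • (f ∣[k] diag(d,1))`, a cusp form of level `Γ₀(N)`
for `M d ∣ N` (via Mathlib's `CuspForm.translate` and `gamma0GL_le_conj`). [folklore] -/
def iotaFun (f : CuspForm (Gamma0 M) k) : CuspForm (Gamma0 N) k :=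
  (d : ℂ) ^ (1 - k) • cuspFormOfLE (gamma0GL_le_conj h) (CuspForm.translate f (tpD d))

/-- Unfolding `iotaFun`. [folklore] -/
lemma coe_iotaFun (f : CuspForm (Gamma0 M) k) :
    (⇑(iotaFun M N d k h f) : ℍ → ℂ) = (d : ℂ) ^ (1 - k) • (⇑f ∣[k] tpD d) := rfl

/-- The **degeneracy map** `ι_d : S_k(Γ₀(M)) →ₗ[ℂ] S_k(Γ₀(N))` for `M d ∣ N`,
`ι_d = d^{1-k} [diag(d,1)]_k`, i.e. `(ι_d f)(τ) = f(dτ)` (Diamond–Shurman §5.7, first display;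
Atkin–Lehner's operator `B_d`). The divisibility hypothesis `h` is what makes `f(dτ)` a form of
level `Γ₀(N)`. [cite: DiamondShurman2005, §5.7 (definition of ι_d)] -/
def iota : CuspForm (Gamma0 M) k →ₗ[ℂ] CuspForm (Gamma0 N) k where
  toFun := iotaFun M N d k h
  map_add' f g := by
    apply DFunLike.ext'
    simp only [coe_iotaFun, CuspForm.coe_add, SlashAction.add_slash, smul_add]
  map_smul' c f := by
    apply DFunLike.ext'
    have hdet : 0 < (tpD d).det.val := by rw [det_tpD]; exact_mod_cast NeZero.pos d
    have hσ : σ (tpD d) c = c := σ_eq_self hdet c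
    simp only [coe_iotaFun, CuspForm.IsGLPos.coe_smul, ModularForm.smul_slash, hσ,
      RingHom.id_apply, smul_comm c]

/-- Unfolding `ι_d` as a function: `d^{1-k} • (f ∣[k] diag(d,1))`. [folklore] -/
lemma coe_iota (f : CuspForm (Gamma0 M) k) :
    (⇑(iota M N d k h f) : ℍ → ℂ) = (d : ℂ) ^ (1 - k) • (⇑f ∣[k] tpD d) := rfl

/-- `(ι_d f)(τ) = f(diag(d,1) • τ)`. [folklore] -/
lemma iota_apply (f : CuspForm (Gamma0 M) k) (τ : ℍ) :
    iota M N d k h f τ = f (tpD d • τ) := by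
  change (d : ℂ) ^ (1 - k) * ((⇑f) ∣[k] tpD d) τ = _
  rw [slash_tpD_apply, ← mul_assoc, ← zpow_add₀ (by exact_mod_cast NeZero.ne d)]
  simp

/-- `(ι_d f)(τ) = f(dτ)` (Diamond–Shurman §5.7). [folklore] -/
lemma coe_iota_apply (f : CuspForm (Gamma0 M) k) (τ : ℍ) :
    iota M N d k h f τ =
      f ⟨(d : ℂ) * τ, by simpa using mul_pos (Nat.cast_pos.mpr (NeZero.pos d)) τ.2⟩ := by
  rw [iota_apply]
  congr 1
  ext1
  simpa using coe_tpD_smul d τ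

/-- `ι_d` is injective (`τ ↦ dτ` is onto `ℍ`). [folklore] -/
lemma iota_injective : Function.Injective (iota M N d k h) := by
  intro f g hfg
  ext τ
  have hd : (0 : ℝ) < d := Nat.cast_pos.mpr (NeZero.pos d)
  set τ' : ℍ := ⟨(d : ℂ)⁻¹ * τ, by
    simpa [Complex.mul_im, Complex.inv_re, Complex.inv_im] using
      mul_pos (by positivity : (0 : ℝ) < (d : ℝ)⁻¹) τ.2⟩ with hτ'
  have := congrArg (fun F : CuspForm (Gamma0 N) k ↦ F τ') hfg
  simp only [coe_iota_apply] at this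
  convert this using 2 <;>
  · ext1
    simp [hτ', ← mul_assoc, mul_inv_cancel₀ (show (d : ℂ) ≠ 0 by exact_mod_cast NeZero.ne d)]

/-- **`q`-expansion of `ι_d`**: `a_n(ι_d f) = a_{n/d}(f)` if `d ∣ n` and `0` otherwise, i.e.
`ι_d (Σ a_n qⁿ) = Σ a_n q^{dn}` (Diamond–Shurman §5.7, second display). [cite: DiamondShurman2005, §5.7 (ι_d on Fourier expansions)] -/
lemma qExpansion_coeff_iota (f : CuspForm (Gamma0 M) k) (n : ℕ) :
    (qExpansion 1 ⇑(iota M N d k h f)).coeff n =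
      if d ∣ n then (qExpansion 1 ⇑f).coeff (n / d) else 0 := by
  symm
  refine ModularFormClass.qExpansion_coeff_unique one_pos (one_mem_strictPeriods_gamma0 N)
    (f := iota M N d k h f) (c := fun m ↦ if d ∣ m then (qExpansion 1 ⇑f).coeff (m / d) else 0)
    (fun τ ↦ ?_) n
  have hd : 0 < d := NeZero.pos d
  set τ' : ℍ := ⟨(d : ℂ) * τ, by simpa using mul_pos (Nat.cast_pos.mpr hd) τ.2⟩ with hτ'
  have hf := hasSum_qExpansion_of_mem_strictPeriods one_pos (one_mem_strictPeriods_gamma0 M) f τ'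
  rw [coe_iota_apply]
  have hq : Function.Periodic.qParam 1 (τ' : ℂ) = Function.Periodic.qParam 1 τ ^ d :=
    qParam_one_natMul d τ
  rw [hq] at hf
  refine ((mul_right_injective₀ hd.ne').hasSum_iff ?_).mp ?_
  · intro m hm
    have : ¬ d ∣ m := by
      rintro ⟨j, rfl⟩
      exact hm ⟨j, rfl⟩
    simp [this]
  · convert hf using 1
    ext m
    simp [Function.comp, Nat.mul_div_cancel_left _ hd, pow_mul]

/-! ### `degeneracyMap0 = d^{k-1} ι_d` and the old subspace -/

variable [NeZero M] [NeZero N]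

include h in
/-- The degeneracy map `degeneracyMap0 M N d k = [Γ₀(M) diag(d,1) Γ₀(N)]` of `Newforms.lean` is,
for `M d ∣ N`, the single term `f ∣[k] diag(d,1)`: the double coset is the single coset
`Γ₀(M) diag(d,1)` since `diag(d,1) Γ₀(N) diag(d,1)⁻¹ ⊆ Γ₀(M)` (`gamma0GL_le_conj`), so Mathlib's
trace runs over a one-point quotient (Diamond–Shurman §5.1, Exercise 5.1.4; §5.6). [folklore] -/
lemma coe_degeneracyMap0 (f : CuspForm (Gamma0 M) k) :
    (⇑(degeneracyMap0 M N d k f) : ℍ → ℂ) = ⇑f ∣[k] tpD d := by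
  change ⇑(CuspForm.trace _ (CuspForm.translate f
    (glCast (diagGL d 1 (Nat.cast_pos.mpr (NeZero.pos d)) one_pos : GL (Fin 2) ℚ)))) = _
  rw [CuspForm.coe_trace]
  set Δ : Subgroup (GL (Fin 2) ℝ) :=
    toConjAct (glCast (diagGL d 1 (Nat.cast_pos.mpr (NeZero.pos d)) one_pos : GL (Fin 2) ℚ))⁻¹ •
      ((Gamma0 M : Subgroup SL(2, ℤ)) : Subgroup (GL (Fin 2) ℝ)) with hΔ
  set Γ' : Subgroup (GL (Fin 2) ℝ) := ((Gamma0 N : Subgroup SL(2, ℤ)) : Subgroup (GL (Fin 2) ℝ))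
  have hH : Δ.subgroupOf Γ' = ⊤ := by
    rw [Subgroup.subgroupOf_eq_top]
    exact gamma0GL_le_conj h
  haveI : Subsingleton (Γ' ⧸ Δ.subgroupOf Γ') := by
    rw [hH]; exact QuotientGroup.subsingleton_quotient_top
  letI : Fintype (Γ' ⧸ Δ.subgroupOf Γ') := Fintype.ofFinite _
  convert Fintype.sum_subsingleton
    (fun q : Γ' ⧸ Δ.subgroupOf Γ' ↦ SlashInvariantForm.quotientFunc (k := k)
      (CuspForm.translate f
        (glCast (diagGL d 1 (Nat.cast_pos.mpr (NeZero.pos d)) one_pos : GL (Fin 2) ℚ))) q)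
    (⟦1⟧ : Γ' ⧸ Δ.subgroupOf Γ') using 1
  rw [SlashInvariantForm.quotientFunc_mk]
  simp only [OneMemClass.coe_one, inv_one, SlashAction.slash_one]
  rfl

/-- `degeneracyMap0 M N d k = d^{k-1} • ι_d` for `M d ∣ N` (Diamond–Shurman §5.7:
`ι_d = d^{1-k}[α_d]_k`). [folklore] -/
lemma degeneracyMap0_eq_smul_iota (f : CuspForm (Gamma0 M) k) :
    degeneracyMap0 M N d k f = (d : ℂ) ^ (k - 1) • iota M N d k h f := by
  apply DFunLike.ext'
  rw [coe_degeneracyMap0 M N d k h, CuspForm.IsGLPos.coe_smul, coe_iota, smul_smul,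
    ← zpow_add₀ (by exact_mod_cast NeZero.ne d)]
  simp

/-- `range ι_d = range degeneracyMap0` (they differ by the unit `d^{k-1}`). [folklore] -/
lemma range_iota_eq_range_degeneracyMap0 :
    LinearMap.range (iota M N d k h) = LinearMap.range (degeneracyMap0 M N d k) := by
  have hu : ((d : ℂ) ^ (k - 1)) ≠ 0 := zpow_ne_zero _ (by exact_mod_cast NeZero.ne d)
  have : degeneracyMap0 M N d k = (d : ℂ) ^ (k - 1) • iota M N d k h := by
    ext1 f; simp [degeneracyMap0_eq_smul_iota M N d k h]
  rw [this, LinearMap.range_smul _ _ hu]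

/-- For `M` a proper divisor of `N` and `M d ∣ N`, `ι_d (S_k(Γ₀(M))) ⊆ S_k(Γ₀(N))^{old}`
(`oldSubspace0` of `Newforms.lean`; Diamond–Shurman Def. 5.6.1). [folklore] -/
lemma range_iota_le_oldSubspace0 (hM : M ∈ N.properDivisors) :
    LinearMap.range (iota M N d k h) ≤ oldSubspace0 N k := by
  rw [range_iota_eq_range_degeneracyMap0 M N d k h]
  exact le_iSup (fun Md : DegeneracyIndex N ↦ LinearMap.range (degeneracyMap0 Md.1.1 N Md.1.2 k))
    ⟨(M, d), hM, h⟩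

end Iota

/-! ### The operators `U_p` and the sieve `K_p = 1 - ι_p U_p` -/

section QExpAPI

variable {N : ℕ} {k : ℤ}

/-- `a_n(f - g) = a_n(f) - a_n(g)` on `S_k(Γ₀(N))`. [folklore] -/
lemma qExpansion_coeff_sub_level0 (f g : CuspForm (Gamma0 N) k) (n : ℕ) :
    (qExpansion 1 ⇑(f - g)).coeff n = (qExpansion 1 ⇑f).coeff n - (qExpansion 1 ⇑g).coeff n := by
  rw [CuspForm.coe_sub, ModularForm.qExpansion_sub one_pos (one_mem_strictPeriods_gamma0 N) f g]
  simp

/-- `a_n(f + g) = a_n(f) + a_n(g)` on `S_k(Γ₀(N))`. [folklore] -/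
lemma qExpansion_coeff_add_level0 (f g : CuspForm (Gamma0 N) k) (n : ℕ) :
    (qExpansion 1 ⇑(f + g)).coeff n = (qExpansion 1 ⇑f).coeff n + (qExpansion 1 ⇑g).coeff n := by
  rw [CuspForm.coe_add, ModularForm.qExpansion_add one_pos (one_mem_strictPeriods_gamma0 N) f g]
  simp

/-- A cusp form on `Γ₀(N)` all of whose `q`-expansion coefficients vanish is zero. [folklore] -/
lemma eq_zero_of_qExpansion_coeff_eq_zero_level0 (f : CuspForm (Gamma0 N) k)
    (hf : ∀ n, (qExpansion 1 ⇑f).coeff n = 0) : f = 0 := by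
  have h0 : qExpansion 1 ⇑f = 0 := by ext n; simpa using hf n
  have := coe_eq_zero_of_qExpansion_eq_zero one_pos (one_mem_strictPeriods_gamma0 N) f h0
  exact DFunLike.ext' (by simpa using this)

end QExpAPI

section Sieve

variable (M : ℕ) [NeZero M] (k : ℤ) (p : ℕ) [NeZero p]

/-- The operator **`U_p`** on `S_k(Γ₀(M))`, realised at level `Γ₀(Mp)`:
`U_p f := T_p f - 𝟙_{p∤M} p^{k-1} ι_p f`, so that `a_n(U_p f) = a_{pn}(f)`
(`qExpansion_coeff_uOp`; Diamond–Shurman (5.2)–Prop. 5.2.2, Atkin–Lehner's `U_p`). For `p ∣ M` it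
is (the level-`Mp` image of) `T_p` itself. [folklore] -/
def uOp : CuspForm (Gamma0 M) k →ₗ[ℂ] CuspForm (Gamma0 (M * p)) k :=
  toLevel0 (dvd_mul_right M p) k ∘ₗ heckeT (Gamma0 M) k p -
    (if p ∣ M then (0 : ℂ) else (p : ℂ) ^ (k - 1)) • iota M (M * p) p k dvd_rfl

/-- The **sieve** `K_p := incl - ι_p ∘ U_p : S_k(Γ₀(M)) → S_k(Γ₀(Mp²))`, which kills the
coefficients at the multiples of `p`: `a_n(K_p f) = 𝟙_{p∤n} a_n(f)` (`qExpansion_coeff_sieveOp`;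
Atkin–Lehner's `f ↦ f - f∣U_p∣B_p`). [folklore] -/
def sieveOp : CuspForm (Gamma0 M) k →ₗ[ℂ] CuspForm (Gamma0 (M * p * p)) k :=
  toLevel0 (⟨p * p, by ring⟩ : M ∣ M * p * p) k -
    iota (M * p) (M * p * p) p k dvd_rfl ∘ₗ uOp M k p

variable {M k p}

/-- **`a_n(U_p f) = a_{pn}(f)`** for `p` prime, from the `q`-expansion of `T_p`
(`qExpansion_coeff_heckeT_holds`, Diamond–Shurman Prop. 5.2.2(a)) and of `ι_p`. [folklore] -/
lemma qExpansion_coeff_uOp (hp : p.Prime) (f : CuspForm (Gamma0 M) k) (n : ℕ) :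
    (qExpansion 1 ⇑(uOp M k p f)).coeff n = (qExpansion 1 ⇑f).coeff (p * n) := by
  simp only [uOp, LinearMap.sub_apply, LinearMap.comp_apply, LinearMap.smul_apply,
    qExpansion_coeff_sub_level0, qExpansion_toLevel0, qExpansion_coeff_smul,
    qExpansion_coeff_iota, qExpansion_coeff_heckeT_holds M k f p hp n]
  split_ifs <;> ring

/-- **`a_n(K_p f) = 0` if `p ∣ n` and `a_n(f)` otherwise**, for `p` prime. [folklore] -/
lemma qExpansion_coeff_sieveOp (hp : p.Prime) (f : CuspForm (Gamma0 M) k) (n : ℕ) :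
    (qExpansion 1 ⇑(sieveOp M k p f)).coeff n =
      if p ∣ n then 0 else (qExpansion 1 ⇑f).coeff n := by
  simp only [sieveOp, LinearMap.sub_apply, LinearMap.comp_apply, qExpansion_coeff_sub_level0,
    qExpansion_toLevel0, qExpansion_coeff_iota, qExpansion_coeff_uOp hp]
  split_ifs with hpn
  · rw [Nat.mul_div_cancel' hpn, sub_self]
  · rw [sub_zero]

end Sieve

/-! ### The two Atkin–Lehner lemmas (named facts, D-0014) -/

section Facts

variable (N : ℕ) [NeZero N] (k : ℤ)

/-- For a prime factor `p` of `N`, `(N / p) · p ∣ N`. [folklore] -/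
lemma div_mul_dvd_of_mem_primeFactors {N : ℕ} (p : N.primeFactors) : N / p * p ∣ N :=
  dvd_of_eq (Nat.div_mul_cancel (Nat.dvd_of_mem_primeFactors p.2))

/-- A prime factor of `N` is nonzero (instance on the H21-side subtype `↥N.primeFactors`, used to
form `ι_p`; no Mathlib instance is shadowed). [folklore] -/
instance neZero_of_mem_primeFactors {N : ℕ} (p : N.primeFactors) : NeZero (p : ℕ) :=
  ⟨(Nat.prime_of_mem_primeFactors p.2).ne_zero⟩

/-- For a prime factor `p` of `N ≠ 0`, the level `N / p` is nonzero (instance on the H21-side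
subtype `↥N.primeFactors`; no Mathlib instance is shadowed). [folklore] -/
instance neZero_div_of_mem_primeFactors {N : ℕ} [NeZero N] (p : N.primeFactors) :
    NeZero (N / (p : ℕ)) :=
  ⟨(Nat.div_pos (Nat.le_of_dvd (NeZero.pos N) (Nat.dvd_of_mem_primeFactors p.2))
    (Nat.prime_of_mem_primeFactors p.2).pos).ne'⟩

/-- **Atkin–Lehner Main Lemma** for `Γ₀(N)` (trivial character): if `f ∈ S_k(Γ₀(N))` has
`q`-expansion `Σ a_n qⁿ` with `a_n = 0` whenever `(n, N) = 1`, then `f = Σ_{p ∣ N} ι_p f_p` with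
`f_p ∈ S_k(Γ₀(N/p))`, the sum over the primes `p` dividing `N` and `(ι_p f_p)(τ) = f_p(pτ)`
(Atkin–Lehner 1970, Thm. 1 — the theorem Rankin 1977, p. 236 refers to as "theorem 1 of Atkin
and Lehner (1970)" and Diamond–Shurman, p. 192 (PDF p. 212) as "the Main Lemma … due to Atkin and Lehner";
Diamond–Shurman Thm. 5.7.1 prints the `Γ₁(N)`-version, with `f_p ∈ S_k(Γ₁(N/p))`). Stated as
membership of `f` in `Σ_p range ι_p`. The level `N ≥ 1` is part of the statement (instance argument
`[NeZero N]`, as for the sibling facts of `Newforms.lean`; for `N = 0` the family would contain a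
false member). The discharge will be `atkinLehnerMainLemma0_holds`. [cite: AtkinLehner1970, Thm. 1] -/
def atkinLehnerMainLemma0 (N : ℕ) [NeZero N] (k : ℤ) : Prop :=
  ∀ f : CuspForm (Gamma0 N) k,
    (∀ n : ℕ, n.Coprime N → (qExpansion 1 ⇑f).coeff n = 0) →
      f ∈ ⨆ p : N.primeFactors,
        LinearMap.range (iota (N / p) N p k (div_mul_dvd_of_mem_primeFactors p))

/-- Consequence of the Main Lemma in terms of `oldSubspace0` (`Newforms.lean`): a form with
`a_n = 0` for all `(n, N) = 1` is an oldform (Diamond–Shurman Thm. 5.7.1 with Def. 5.6.1). [cite: AtkinLehner1970, Thm. 1] -/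
theorem atkinLehnerMainLemma0.mem_oldSubspace0 (hML : atkinLehnerMainLemma0 N k)
    (f : CuspForm (Gamma0 N) k) (hf : ∀ n : ℕ, n.Coprime N → (qExpansion 1 ⇑f).coeff n = 0) :
    f ∈ oldSubspace0 N k := by
  have hle : (⨆ p : N.primeFactors,
      LinearMap.range (iota (N / p) N p k (div_mul_dvd_of_mem_primeFactors p))) ≤
      oldSubspace0 N k := by
    refine iSup_le fun p ↦ ?_
    refine range_iota_le_oldSubspace0 (N / p) N p k (div_mul_dvd_of_mem_primeFactors p) ?_
    have hp := Nat.prime_of_mem_primeFactors p.2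
    rw [Nat.mem_properDivisors]
    exact ⟨Nat.div_dvd_of_dvd (Nat.dvd_of_mem_primeFactors p.2),
      Nat.div_lt_self (NeZero.pos N) hp.one_lt⟩
  exact hle (hML f hf)

/-- **Vanishing of forms supported on the multiples of a prime not dividing the level.** If `p` is
a prime with `p ∤ N` and `f ∈ S_k(Γ₀(N))` has `a_n(f) = 0` for every `n` with `p ∤ n` (i.e.
`f(τ) = F(pτ)` for a `q`-series `F`), then `f = 0`. A standard lemma of Atkin–Lehner theory
(it fails for `p ∣ N`: `f = ι_p g`, `g ∈ S_k(Γ₀(N/p))`). Proof route (module docstring):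
`p · (f ∣[k] diag(1,p))` is again of level `Γ₀(N)` because `Γ₀(N)` is
generated by `T` and `Γ₀(N) ∩ Γ⁰(p)`; with the `q`-expansion of `T_p` this puts `f(p^r τ)` in
`S_k(Γ₀(N))` for all `r`, contradicting the Sturm bound unless `f = 0` — carried out below,
`eq_zero_of_coeff_eq_zero_of_not_dvd_level0_holds`. The level `N ≥ 1` is part of the statement
(instance argument `[NeZero N]`). [folklore] -/
def eq_zero_of_coeff_eq_zero_of_not_dvd_level0 (N : ℕ) [NeZero N] (k : ℤ) : Prop :=
  ∀ (p : ℕ), p.Prime → ¬ p ∣ N → ∀ f : CuspForm (Gamma0 N) k,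
    (∀ n : ℕ, ¬ p ∣ n → (qExpansion 1 ⇑f).coeff n = 0) → f = 0

end Facts


/-! ## Proof of the level-raising vanishing lemma -/


section Matrices

variable (p : ℕ) [NeZero p]

/-- `tpB p 0 = tpG p = diag(1, p)`. [folklore] -/
lemma tpB_zero : tpB p 0 = tpG p := by
  simp [tpB]

/-- `(1 j; 0 p) T = (1 j+1; 0 p)`. [folklore] -/
lemma tpB_mul_T (j : ℤ) : tpB p j * mapGL ℝ T = tpB p (j + 1) := by
  simp only [tpB, mul_assoc, ← map_mul, zpow_add_one]

/-- `diag(1,p) Tᵖ = T diag(1,p)`. [folklore] -/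
lemma tpG_mul_T_pow : tpG p * mapGL ℝ (T ^ (p : ℤ)) = mapGL ℝ T * tpG p := by
  ext i j
  rw [Matrix.GeneralLinearGroup.coe_mul, Matrix.GeneralLinearGroup.coe_mul, val_tpG, val_mapGL',
    val_mapGL', coe_T_zpow, coe_T]
  fin_cases i <;> fin_cases j <;> simp [Matrix.mul_apply, Fin.sum_univ_two]

/-- `(1 j+p; 0 p) = T (1 j; 0 p)`. [folklore] -/
lemma tpB_add_natCast (j : ℤ) : tpB p (j + p) = mapGL ℝ T * tpB p j := by
  simp only [tpB]
  rw [add_comm, zpow_add, map_mul, ← mul_assoc, tpG_mul_T_pow, mul_assoc]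

end Matrices

section Invariance

variable (N : ℕ) (k : ℤ) (p : ℕ) [NeZero p]

/-- The image of `T` in `GL(2, ℝ)` lies in `Γ₀(N)`. [folklore] -/
lemma mapGL_T_mem_gamma0 :
    (mapGL ℝ T : GL (Fin 2) ℝ) ∈ ((Gamma0 N : Subgroup SL(2, ℤ)) : Subgroup (GL (Fin 2) ℝ)) :=
  ⟨T, T_mem_Gamma0 N, rfl⟩

/-- **`U = ∑_{j mod p} f ∣[k] (1 j; 0 p)` is invariant under `T`** for `f` of level `Γ₀(N)`:
right multiplication by `T` permutes the `βⱼ = (1 j; 0 p)` cyclically modulo `Γ₀(N)`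
(`β_{p-1} T = T β₀`; Diamond–Shurman §5.2, the cosets `Γ₀(N)βⱼ`). [folklore] -/
lemma sum_slash_tpB_slash_T (f : CuspForm (Gamma0 N) k) :
    (∑ j : Fin p, ⇑f ∣[k] tpB p ((j : ℕ) : ℤ)) ∣[k] (mapGL ℝ T : GL (Fin 2) ℝ) =
      ∑ j : Fin p, ⇑f ∣[k] tpB p ((j : ℕ) : ℤ) := by
  set g : ℤ → ℍ → ℂ := fun j ↦ ⇑f ∣[k] tpB p j with hg
  have hT : (⇑f : ℍ → ℂ) ∣[k] (mapGL ℝ T : GL (Fin 2) ℝ) = ⇑f :=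
    SlashInvariantFormClass.slash_action_eq f _ (mapGL_T_mem_gamma0 N)
  have hper : ∀ j : ℤ, g (j + p) = g j := fun j ↦ by
    simp only [hg, tpB_add_natCast, SlashAction.slash_mul, hT]
  have hstep : ∀ j : ℤ, g j ∣[k] (mapGL ℝ T : GL (Fin 2) ℝ) = g (j + 1) := fun j ↦ by
    simp only [hg, ← SlashAction.slash_mul, tpB_mul_T]
  rw [SlashAction.sum_slash]
  simp only [show ∀ j : Fin p, ⇑f ∣[k] tpB p ((j : ℕ) : ℤ) = g ((j : ℕ) : ℤ) from fun j ↦ rfl,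
    hstep]
  rw [Fin.sum_univ_eq_sum_range (fun i ↦ g ((i : ℤ) + 1)) p,
    Fin.sum_univ_eq_sum_range (fun i ↦ g (i : ℤ)) p]
  have h1 := Finset.sum_range_succ' (fun i ↦ g (i : ℤ)) p
  have h2 := Finset.sum_range_succ (fun i ↦ g (i : ℤ)) p
  simp only [Nat.cast_add, Nat.cast_one, Nat.cast_zero] at h1 h2
  have h3 : g (p : ℤ) = g 0 := by simpa using hper 0
  rw [h3] at h2
  have := h1.symm.trans h2
  exact add_right_cancel this

variable {N p}

/-- **`f ∣[k] diag(1,p)` is invariant under `Γ₀(N) ∩ Γ⁰(p)`**: for `γ = (a b; c d) ∈ Γ₀(N)` with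
`p ∣ b`, `diag(1,p) γ = γ' diag(1,p)` with `γ' = (a, b/p; pc, d) ∈ Γ₀(N)`
(`exists_mul_tpG_eq_iff` of `HeckeOperatorsProofs`; Diamond–Shurman §5.2, `Γ₃ = Γ₀(N) ∩ Γ⁰(p)`). [folklore] -/
lemma slash_tpG_slash_mapGL_of_dvd (f : CuspForm (Gamma0 N) k) {γ : SL(2, ℤ)} (hγ : γ ∈ Gamma0 N)
    (hb : (p : ℤ) ∣ γ 0 1) :
    ((⇑f : ℍ → ℂ) ∣[k] tpG p) ∣[k] (mapGL ℝ γ : GL (Fin 2) ℝ) = ⇑f ∣[k] tpG p := by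
  obtain ⟨γ', hγ', h⟩ := (exists_mul_tpG_eq_iff p N hγ).mpr hb
  rw [← SlashAction.slash_mul, ← h, SlashAction.slash_mul,
    SlashInvariantFormClass.slash_action_eq f γ' hγ']

omit [NeZero p] in
/-- `(γ Tʲ)₀₁ = a j + b` for `γ = (a b; c d)`. [folklore] -/
lemma mul_T_zpow_apply_zero_one (γ : SL(2, ℤ)) (j : ℤ) :
    (γ * T ^ j) 0 1 = γ 0 0 * j + γ 0 1 := by
  simp [Matrix.SpecialLinearGroup.coe_mul, coe_T_zpow, Matrix.mul_apply, Fin.sum_univ_two]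

omit [NeZero p] in
/-- `(γ Tʲ)₀₀ = a`. [folklore] -/
lemma mul_T_zpow_apply_zero_zero (γ : SL(2, ℤ)) (j : ℤ) : (γ * T ^ j) 0 0 = γ 0 0 := by
  simp [Matrix.SpecialLinearGroup.coe_mul, coe_T_zpow, Matrix.mul_apply, Fin.sum_univ_two]

omit [NeZero p] in
/-- `(T γ)₀₀ = a + c`. [folklore] -/
lemma T_mul_apply_zero_zero (γ : SL(2, ℤ)) : (T * γ) 0 0 = γ 0 0 + γ 1 0 := by
  simp [Matrix.SpecialLinearGroup.coe_mul, coe_T, Matrix.mul_apply, Fin.sum_univ_two]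

omit [NeZero p] in
/-- If `p ∤ a`, some `γ Tʲ` has upper-right entry divisible by `p` (`j ≡ -b/a (mod p)`). [folklore] -/
lemma exists_dvd_mul_T_zpow (hp : p.Prime) (γ : SL(2, ℤ)) (ha : ¬ (p : ℤ) ∣ γ 0 0) :
    ∃ j : ℤ, (p : ℤ) ∣ (γ * T ^ j) 0 1 := by
  have hcop : IsCoprime (γ 0 0) (p : ℤ) := by
    rw [Int.isCoprime_iff_gcd_eq_one, Int.gcd, Int.natAbs_natCast]
    exact Nat.coprime_comm.mp ((Nat.Prime.coprime_iff_not_dvd hp).mpr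
      fun h ↦ ha (Int.natCast_dvd.mpr h))
  obtain ⟨x, y, hxy⟩ := hcop
  refine ⟨-(γ 0 1) * x, ⟨γ 0 1 * y, ?_⟩⟩
  rw [mul_T_zpow_apply_zero_one]
  linear_combination (γ 0 1) * hxy.symm

omit [NeZero p] in
/-- **Generation of `Γ₀(N)` by `T` and `Γ₀(N) ∩ Γ⁰(p)`**: every `γ ∈ Γ₀(N)` is `Tⁱ γ' Tʲ` with
`γ' ∈ Γ₀(N)`, `p ∣ γ'₀₁` (`i ∈ {0, 1}`): if `p ∤ a` take `i = 0`, `γ' = γ T^{j₀}`; if `p ∣ a` then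
`p ∤ c` (determinant), and `Tγ` has upper-left entry `a + c`, prime to `p`. [folklore] -/
lemma exists_eq_T_zpow_mul_mul_T_zpow (hp : p.Prime) {γ : SL(2, ℤ)} (hγ : γ ∈ Gamma0 N) :
    ∃ (i j : ℤ) (γ' : SL(2, ℤ)), γ' ∈ Gamma0 N ∧ (p : ℤ) ∣ γ' 0 1 ∧ γ = T ^ i * γ' * T ^ j := by
  -- the case `p ∤ a`
  have key : ∀ δ : SL(2, ℤ), δ ∈ Gamma0 N → ¬ (p : ℤ) ∣ δ 0 0 →
      ∃ (j : ℤ) (γ' : SL(2, ℤ)), γ' ∈ Gamma0 N ∧ (p : ℤ) ∣ γ' 0 1 ∧ δ = γ' * T ^ j := by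
    intro δ hδ ha
    obtain ⟨j, hj⟩ := exists_dvd_mul_T_zpow hp δ ha
    exact ⟨-j, δ * T ^ j, Subgroup.mul_mem _ hδ (T_zpow_mem_Gamma0 N j), hj, by
      rw [mul_assoc, ← zpow_add, add_neg_cancel, zpow_zero, mul_one]⟩
  by_cases ha : (p : ℤ) ∣ γ 0 0
  · -- `p ∣ a`: then `p ∤ a + c`, since `p ∣ c` would give `p ∣ ad - bc = 1`
    have hac : ¬ (p : ℤ) ∣ (T * γ) 0 0 := by
      rw [T_mul_apply_zero_zero]
      intro hac
      have hc : (p : ℤ) ∣ γ 1 0 := (dvd_add_right ha).mp hac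
      have h1 : (p : ℤ) ∣ γ 0 0 * γ 1 1 - γ 0 1 * γ 1 0 :=
        dvd_sub (dvd_mul_of_dvd_left ha _) (dvd_mul_of_dvd_right hc _)
      rw [det_entries γ] at h1
      exact hp.one_lt.ne' (Nat.dvd_one.mp (Int.natCast_dvd_natCast.mp h1))
    obtain ⟨j, γ', hγ', hdvd, hδ⟩ := key (T * γ) (Subgroup.mul_mem _ (T_mem_Gamma0 N) hγ) hac
    refine ⟨-1, j, γ', hγ', hdvd, ?_⟩
    rw [zpow_neg_one, mul_assoc, ← hδ, ← mul_assoc, inv_mul_cancel, one_mul]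
  · obtain ⟨j, γ', hγ', hdvd, hδ⟩ := key γ hγ ha
    exact ⟨0, j, γ', hγ', hdvd, by simpa using hδ⟩

/-- `F ∣ g = F` implies `F ∣ gⁱ = F` for all `i ∈ ℤ`. [folklore] -/
lemma slash_mapGL_zpow_of_slash_eq {F : ℍ → ℂ} {g : SL(2, ℤ)}
    (h : F ∣[k] (mapGL ℝ g : GL (Fin 2) ℝ) = F) (i : ℤ) :
    F ∣[k] (mapGL ℝ (g ^ i) : GL (Fin 2) ℝ) = F := by
  have h' : F ∣[k] (mapGL ℝ g⁻¹ : GL (Fin 2) ℝ) = F := by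
    conv_lhs => rw [← h]
    rw [← SlashAction.slash_mul, ← map_mul, mul_inv_cancel, map_one, SlashAction.slash_one]
  induction i using Int.induction_on with
  | zero => simp
  | succ i ih => rw [zpow_add_one, map_mul, SlashAction.slash_mul, ih, h]
  | pred i ih => rw [zpow_sub_one, map_mul, SlashAction.slash_mul, ih, h']

/-- If `F = f ∣[k] diag(1,p)` (`f` of level `Γ₀(N)`) is `T`-invariant then it is `Γ₀(N)`-invariant:
combine the generation lemma `exists_eq_T_zpow_mul_mul_T_zpow` with the `Γ₀(N) ∩ Γ⁰(p)`-invariance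
`slash_tpG_slash_mapGL_of_dvd`. [folklore] -/
lemma slash_tpG_slash_mapGL_of_slash_T (hp : p.Prime) (f : CuspForm (Gamma0 N) k)
    (hFT : ((⇑f : ℍ → ℂ) ∣[k] tpG p) ∣[k] (mapGL ℝ T : GL (Fin 2) ℝ) = ⇑f ∣[k] tpG p)
    {γ : SL(2, ℤ)} (hγ : γ ∈ Gamma0 N) :
    ((⇑f : ℍ → ℂ) ∣[k] tpG p) ∣[k] (mapGL ℝ γ : GL (Fin 2) ℝ) = ⇑f ∣[k] tpG p := by
  obtain ⟨i, j, γ', hγ', hdvd, rfl⟩ := exists_eq_T_zpow_mul_mul_T_zpow (N := N) hp hγ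
  rw [map_mul, map_mul, SlashAction.slash_mul, SlashAction.slash_mul,
    slash_mapGL_zpow_of_slash_eq k hFT i, slash_tpG_slash_mapGL_of_dvd k f hγ' hdvd,
    slash_mapGL_zpow_of_slash_eq k hFT j]

/-- If `p · (f ∣[k] diag(1,p)) = ∑ⱼ f ∣[k] (1 j; 0 p)` then `f ∣[k] diag(1,p)` is `T`-invariant
(`sum_slash_tpB_slash_T`). [folklore] -/
lemma slash_tpG_slash_T_of_smul_eq (f : CuspForm (Gamma0 N) k)
    (hU : (p : ℂ) • ((⇑f : ℍ → ℂ) ∣[k] tpG p) = ∑ j : Fin p, ⇑f ∣[k] tpB p ((j : ℕ) : ℤ)) :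
    ((⇑f : ℍ → ℂ) ∣[k] tpG p) ∣[k] (mapGL ℝ T : GL (Fin 2) ℝ) = ⇑f ∣[k] tpG p := by
  have hp0 : (p : ℂ) ≠ 0 := by exact_mod_cast NeZero.ne p
  have hF : (⇑f : ℍ → ℂ) ∣[k] tpG p = (p : ℂ)⁻¹ • ∑ j : Fin p, ⇑f ∣[k] tpB p ((j : ℕ) : ℤ) := by
    rw [← hU, smul_smul, inv_mul_cancel₀ hp0, one_smul]
  have hσ : σ (mapGL ℝ T : GL (Fin 2) ℝ) ((p : ℂ)⁻¹) = (p : ℂ)⁻¹ :=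
    σ_eq_self (by simp [Matrix.SpecialLinearGroup.det_mapGL]) _
  rw [hF, ModularForm.smul_slash, sum_slash_tpB_slash_T, hσ]

/-- **`p · (f ∣[k] diag(1,p)) = ∑ⱼ f ∣[k] (1 j; 0 p)` when the coefficients of `f` live on the
multiples of `p`**: both sides are `∑ₙ a_{pn}(f) qⁿ` — the right side by orthogonality of characters
(`hasSum_sum_slash_tpB`, Diamond–Shurman proof of Prop. 5.2.2(a)), the left side since
`p (f ∣[k] diag(1,p))(τ) = f(τ/p) = ∑ₙ aₙ q^{n/p}` and only `p ∣ n` contribute. [folklore] -/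
lemma smul_slash_tpG_eq_sum_slash_tpB [NeZero N] (hp : p.Prime) (f : CuspForm (Gamma0 N) k)
    (hsupp : ∀ n : ℕ, ¬ p ∣ n → (qExpansion 1 ⇑f).coeff n = 0) :
    (p : ℂ) • ((⇑f : ℍ → ℂ) ∣[k] tpG p) = ∑ j : Fin p, ⇑f ∣[k] tpB p ((j : ℕ) : ℤ) := by
  have hp0 : (p : ℂ) ≠ 0 := by exact_mod_cast NeZero.ne p
  funext τ
  have hU := hasSum_sum_slash_tpB N k p hp f τ
  have hF : ((⇑f : ℍ → ℂ) ∣[k] tpG p) τ = (p : ℂ)⁻¹ * f (tpB p 0 • τ) := by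
    rw [← tpB_zero, slash_tpB_apply]
  have h1 := hasSum_qExpansion_gamma0 N k f (tpB p 0 • τ)
  have h2 : HasSum (fun n : ℕ ↦ (qExpansion 1 ⇑f).coeff (p * n) •
      Function.Periodic.qParam 1 (τ : ℂ) ^ n) (f (tpB p 0 • τ)) := by
    have hinj : Function.Injective (fun n : ℕ ↦ p * n) := mul_right_injective₀ hp.ne_zero
    have key := (hinj.hasSum_iff (f := fun m : ℕ ↦ (qExpansion 1 ⇑f).coeff m •
        Function.Periodic.qParam 1 ((tpB p 0 • τ : ℍ) : ℂ) ^ m) ?_).mpr h1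
    · convert key using 1
      funext n
      simp only [Function.comp_apply, qParam_tpB_smul_pow, mul_zero, zpow_zero, mul_one,
        exp_mul_eq_qParam_pow]
    · intro m hm
      have : ¬ p ∣ m := by
        rintro ⟨c, rfl⟩
        exact hm ⟨c, rfl⟩
      rw [hsupp m this, zero_smul]
  rw [Pi.smul_apply, hF, smul_eq_mul, ← mul_assoc, mul_inv_cancel₀ hp0, one_mul]
  exact h2.unique hU

end Invariance


/-! ### Level raising: `f(τ/p) ∈ S_k(Γ₀(N))` for `p`-supported `f`, and `f(pτ) ∈ S_k(Γ₀(N))` -/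

section LevelRaise

variable {N : ℕ} [NeZero N] {k : ℤ} {p : ℕ} [NeZero p]

/-- The level `diag(1,p)⁻¹ Γ₀(N) diag(1,p)` of `f ∣[k] diag(1,p)` is arithmetic (Mathlib
`Subgroup.IsArithmetic.conj`, through `isArithmetic_conj_glCast_inv` of `HeckeOperators`). [folklore] -/
lemma isArithmetic_conj_tpG :
    (toConjAct (tpG p)⁻¹ • ((Gamma0 N : Subgroup SL(2, ℤ)) : Subgroup (GL (Fin 2) ℝ))).IsArithmetic := by
  unfold tpG
  infer_instance

/-- **Level raising by `p` (division)**: if `p` is prime and `f ∈ S_k(Γ₀(N))` has `a_n(f) = 0` for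
all `p ∤ n`, then `τ ↦ f(τ/p) = p · (f ∣[k] diag(1,p))(τ)` is again a cusp form of level
`Γ₀(N)`: it is invariant under `Γ₀(N) ∩ Γ⁰(p)` by conjugation and under `T` because it equals
`∑ⱼ f ∣[k] (1 j; 0 p)` (`smul_slash_tpG_eq_sum_slash_tpB`), and these generate `Γ₀(N)`
(`exists_eq_T_zpow_mul_mul_T_zpow`); holomorphy and vanishing at all cusps are those of the
translate `f ∣[k] diag(1,p)` (Mathlib `CuspForm.translate`). (Atkin–Lehner theory; the case
`(u, N/N_χ) = 1` of the argument in Rankin 1977, Thm. 8.3.4.) [folklore] -/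
def divLevelRaise (hp : p.Prime) (f : CuspForm (Gamma0 N) k)
    (hsupp : ∀ n : ℕ, ¬ p ∣ n → (qExpansion 1 ⇑f).coeff n = 0) : CuspForm (Gamma0 N) k where
  toFun := (p : ℂ) • ((⇑f : ℍ → ℂ) ∣[k] tpG p)
  slash_action_eq' A hA := by
    obtain ⟨γ, hγ, rfl⟩ := hA
    have hinv := slash_tpG_slash_mapGL_of_slash_T k hp f
      (slash_tpG_slash_T_of_smul_eq k f (smul_slash_tpG_eq_sum_slash_tpB k hp f hsupp)) hγ
    have hσ : σ (mapGL ℝ γ : GL (Fin 2) ℝ) (p : ℂ) = p :=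
      σ_eq_self (by simp [Matrix.SpecialLinearGroup.det_mapGL]) _
    rw [ModularForm.smul_slash, hσ, hinv]
  holo' := ((f.holo').slash k (tpG p)).const_smul _
  zero_at_cusps' {c} hc := by
    haveI := isArithmetic_conj_tpG (N := N) (p := p)
    have hc' : IsCusp c (toConjAct (tpG p)⁻¹ •
        ((Gamma0 N : Subgroup SL(2, ℤ)) : Subgroup (GL (Fin 2) ℝ))) :=
      (Subgroup.IsArithmetic.isCusp_iff_isCusp_SL2Z _).mpr
        ((Subgroup.IsArithmetic.isCusp_iff_isCusp_SL2Z _).mp hc)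
    intro g hg
    have hz := (CuspForm.translate f (tpG p)).zero_at_cusps' hc' g hg
    change IsZeroAtImInfty (((p : ℂ) • ((⇑f : ℍ → ℂ) ∣[k] tpG p)) ∣[k] g)
    rw [ModularForm.smul_slash]
    exact hz.smul _

/-- `divLevelRaise f = p · (f ∣[k] diag(1,p))` as a function, i.e. `τ ↦ f(τ/p)`. [folklore] -/
lemma coe_divLevelRaise (hp : p.Prime) (f : CuspForm (Gamma0 N) k)
    (hsupp : ∀ n : ℕ, ¬ p ∣ n → (qExpansion 1 ⇑f).coeff n = 0) :
    (⇑(divLevelRaise hp f hsupp) : ℍ → ℂ) = (p : ℂ) • ((⇑f : ℍ → ℂ) ∣[k] tpG p) := rfl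

/-- **Level raising by `p` (multiplication)**: for `p ∤ N` prime and `f ∈ S_k(Γ₀(N))` supported
on the multiples of `p`, `τ ↦ f(pτ) = p^{1-k} (f ∣[k] diag(p,1))(τ)` is a cusp form of level
`Γ₀(N)`, namely `p^{1-k} (T_p f - f(·/p))` by Diamond–Shurman Prop. 5.2.1
(`coe_heckeT_gamma0_eq_sum`: `T_p f = ∑ⱼ f ∣ (1 j; 0 p) + f ∣ diag(p,1)`). The definition is total in
`p`; for `p ∣ N` it is `0` (junk: then `T_p f = f(·/p)`), and every lemma about it below assumes
`p ∤ N`. [folklore] -/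
def mulLevelRaise (hp : p.Prime) (f : CuspForm (Gamma0 N) k)
    (hsupp : ∀ n : ℕ, ¬ p ∣ n → (qExpansion 1 ⇑f).coeff n = 0) : CuspForm (Gamma0 N) k :=
  (p : ℂ) ^ (1 - k) • (heckeT (Gamma0 N) k p f - divLevelRaise hp f hsupp)

/-- `mulLevelRaise f = p^{1-k} · (f ∣[k] diag(p,1))` as a function, i.e. `τ ↦ f(pτ)`. [folklore] -/
lemma coe_mulLevelRaise (hp : p.Prime) (hpN : ¬ p ∣ N) (f : CuspForm (Gamma0 N) k)
    (hsupp : ∀ n : ℕ, ¬ p ∣ n → (qExpansion 1 ⇑f).coeff n = 0) :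
    (⇑(mulLevelRaise hp f hsupp) : ℍ → ℂ) = (p : ℂ) ^ (1 - k) • ((⇑f : ℍ → ℂ) ∣[k] tpD p) := by
  rw [mulLevelRaise, CuspForm.IsGLPos.coe_smul, CuspForm.coe_sub, coe_heckeT_gamma0_eq_sum N k p hp f,
    if_neg hpN, coe_divLevelRaise, smul_slash_tpG_eq_sum_slash_tpB k hp f hsupp, add_sub_cancel_left]

/-- **`q`-expansion of `f(pτ)`**: `a_n = a_{n/p}(f)` if `p ∣ n`, else `0` (`hasSum_slash_tpD`). [folklore] -/
lemma qExpansion_coeff_mulLevelRaise (hp : p.Prime) (hpN : ¬ p ∣ N) (f : CuspForm (Gamma0 N) k)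
    (hsupp : ∀ n : ℕ, ¬ p ∣ n → (qExpansion 1 ⇑f).coeff n = 0) (n : ℕ) :
    (qExpansion 1 ⇑(mulLevelRaise hp f hsupp)).coeff n =
      if p ∣ n then (qExpansion 1 ⇑f).coeff (n / p) else 0 := by
  symm
  refine ModularFormClass.qExpansion_coeff_unique one_pos (one_mem_strictPeriods_gamma0 N)
    (f := mulLevelRaise hp f hsupp)
    (c := fun m ↦ if p ∣ m then (qExpansion 1 ⇑f).coeff (m / p) else 0) (fun τ ↦ ?_) n
  have h := (hasSum_slash_tpD N k p hp f τ).mul_left ((p : ℂ) ^ (1 - k))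
  have hp0 : (p : ℂ) ≠ 0 := by exact_mod_cast NeZero.ne p
  have hfun : (fun i : ℕ ↦ (p : ℂ) ^ (1 - k) * (((p : ℂ) ^ (k - 1) *
      (if p ∣ i then (qExpansion 1 ⇑f).coeff (i / p) else 0)) •
        Function.Periodic.qParam 1 (τ : ℂ) ^ i)) =
      fun i : ℕ ↦ (if p ∣ i then (qExpansion 1 ⇑f).coeff (i / p) else 0) •
        Function.Periodic.qParam 1 (τ : ℂ) ^ i := by
    funext i
    simp only [smul_eq_mul, ← mul_assoc, ← zpow_add₀ hp0, show (1 - k) + (k - 1) = 0 by ring,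
      zpow_zero, one_mul]
  rw [hfun] at h
  rw [coe_mulLevelRaise hp hpN, Pi.smul_apply, smul_eq_mul]
  exact h

/-- One step: from a `p`-supported `f` (with `p ∤ N`) to a cusp form `f₁` of the same level with
`a_n(f₁) = 𝟙_{p∣n} a_{n/p}(f)` (namely `f₁(τ) = f(pτ)`). [folklore] -/
lemma exists_qExpansion_coeff_eq_div (hp : p.Prime) (hpN : ¬ p ∣ N) (f : CuspForm (Gamma0 N) k)
    (hsupp : ∀ n : ℕ, ¬ p ∣ n → (qExpansion 1 ⇑f).coeff n = 0) :
    ∃ f₁ : CuspForm (Gamma0 N) k, ∀ n : ℕ,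
      (qExpansion 1 ⇑f₁).coeff n = if p ∣ n then (qExpansion 1 ⇑f).coeff (n / p) else 0 :=
  ⟨mulLevelRaise hp f hsupp, qExpansion_coeff_mulLevelRaise hp hpN f hsupp⟩

/-- Iteration: a cusp form `f_r` of level `Γ₀(N)` with `a_n(f_r) = 𝟙_{p^r ∣ n} a_{n/p^r}(f)`
(`f_r(τ) = f(p^r τ)`). [folklore] -/
lemma exists_qExpansion_coeff_eq_div_pow (hp : p.Prime) (hpN : ¬ p ∣ N) (r : ℕ) :
    ∀ f : CuspForm (Gamma0 N) k, (∀ n : ℕ, ¬ p ∣ n → (qExpansion 1 ⇑f).coeff n = 0) →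
      ∃ fr : CuspForm (Gamma0 N) k, ∀ n : ℕ,
        (qExpansion 1 ⇑fr).coeff n = if p ^ r ∣ n then (qExpansion 1 ⇑f).coeff (n / p ^ r) else 0 := by
  induction r with
  | zero =>
    intro f _
    exact ⟨f, fun n ↦ by simp⟩
  | succ r ih =>
    intro f hsupp
    obtain ⟨f₁, hf₁⟩ := exists_qExpansion_coeff_eq_div hp hpN f hsupp
    have hsupp₁ : ∀ n : ℕ, ¬ p ∣ n → (qExpansion 1 ⇑f₁).coeff n = 0 := fun n hn ↦ by
      rw [hf₁, if_neg hn]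
    obtain ⟨fr, hfr⟩ := ih f₁ hsupp₁
    refine ⟨fr, fun n ↦ ?_⟩
    rw [hfr]
    by_cases h1 : p ^ r ∣ n
    · obtain ⟨m, rfl⟩ := h1
      have hpr : 0 < p ^ r := pow_pos hp.pos r
      rw [if_pos (dvd_mul_right _ _), Nat.mul_div_cancel_left m hpr, hf₁]
      by_cases h2 : p ∣ m
      · obtain ⟨l, rfl⟩ := h2
        rw [if_pos (dvd_mul_right p l), if_pos ⟨l, by ring⟩, Nat.mul_div_cancel_left l hp.pos,
          show p ^ r * (p * l) = p ^ (r + 1) * l by ring,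
          Nat.mul_div_cancel_left l (pow_pos hp.pos _)]
      · rw [if_neg h2, if_neg]
        rintro ⟨l, hl⟩
        apply h2
        refine ⟨l, Nat.eq_of_mul_eq_mul_left hpr ?_⟩
        rw [hl]; ring
    · rw [if_neg h1, if_neg]
      exact fun h ↦ h1 ((pow_dvd_pow p (Nat.le_succ r)).trans h)

variable (N k)

/-- **Discharge of `eq_zero_of_coeff_eq_zero_of_not_dvd_level0`**: a cusp form `f ∈ S_k(Γ₀(N))`
whose `q`-expansion coefficients live on the multiples of a prime `p ∤ N` is zero. Proof:
`f(p^r τ) ∈ S_k(Γ₀(N))` for every `r` (`exists_qExpansion_coeff_eq_div_pow`, built from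
`divLevelRaise`/`mulLevelRaise`), with `a_n = 0` for all `n < p^r`; for `p^r` beyond the
cuspidal Sturm bound of `Γ₀(N)` (`cuspForm_eq_zero_of_qExpansion_coeff_eq_zero` of
`ModularCurveSturmProofs`; Sturm 1987, Thm. 1) this form vanishes, hence so do all `a_n(f)`. [folklore] -/
theorem eq_zero_of_coeff_eq_zero_of_not_dvd_level0_holds :
    eq_zero_of_coeff_eq_zero_of_not_dvd_level0 N k := by
  intro p hp hpN f hsupp
  haveI : NeZero p := ⟨hp.ne_zero⟩
  set X : ℕ := (k * Nat.card (𝒮ℒ ⧸ (((Gamma0 N : Subgroup SL(2, ℤ)) : Subgroup (GL (Fin 2) ℝ))).subgroupOf 𝒮ℒ)).toNat / 12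
    with hX
  obtain ⟨fr, hfr⟩ := exists_qExpansion_coeff_eq_div_pow (k := k) hp hpN (X + 2) f hsupp
  have hpow : X + 2 < p ^ (X + 2) := Nat.lt_pow_self hp.one_lt
  have hfr0 : fr = 0 := by
    refine cuspForm_eq_zero_of_qExpansion_coeff_eq_zero (one_mem_strictPeriods_gamma0 N) fr
      (m := p ^ (X + 2)) (fun i hi ↦ ?_) ?_
    · rw [hfr]
      split_ifs with h
      · obtain rfl : i = 0 := Nat.eq_zero_of_dvd_of_lt h hi
        rw [Nat.zero_div]
        exact CuspFormClass.qExpansion_coeff_zero f one_pos (one_mem_strictPeriods_gamma0 N)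
      · rfl
    · rw [← hX]
      omega
  have hall : ∀ n : ℕ, (qExpansion 1 ⇑f).coeff n = 0 := fun n ↦ by
    have := hfr (p ^ (X + 2) * n)
    rw [hfr0, if_pos (dvd_mul_right _ _), Nat.mul_div_cancel_left n (pow_pos hp.pos _)] at this
    simpa [CuspForm.coe_zero, qExpansion_zero] using this.symm
  exact eq_zero_of_qExpansion_coeff_eq_zero_level0 f hall

end LevelRaise


/-! ## Strong multiplicity one: reduction to the Main Lemma and to `old ∩ new = 0` -/


/-! ### Step 1: coefficients of an eigenform from its eigenvalues -/

section Recursion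

variable {N : ℕ} [NeZero N] {k : ℤ}

/-- For a Hecke eigenform, `a_n(T_p f) = λ_p(f) a_n(f)` (`T_p f = λ_p f` and homogeneity of
coefficients). [folklore] -/
lemma qExpansion_coeff_heckeT_of_isHeckeEigenform {f : CuspForm (Gamma0 N) k}
    (hf : IsHeckeEigenform f) {p : ℕ} (hp : p.Prime) (n : ℕ) :
    (qExpansion 1 ⇑(haveI : NeZero p := ⟨hp.ne_zero⟩; heckeT (Gamma0 N) k p f)).coeff n =
      heckeEigenvalue f p * (qExpansion 1 ⇑f).coeff n := by
  haveI : NeZero p := ⟨hp.ne_zero⟩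
  have h := heckeT_eq_heckeEigenvalue_smul f p (hf p hp)
  rw [h, qExpansion_coeff_smul]

/-- **Hecke recursion for eigenforms on `Γ₀(N)`**: if `T_p f = λ_p f` (`p` prime) then for every
`m`, `λ_p a_m(f) = a_{pm}(f) + 𝟙_{p∤N} p^{k-1} 𝟙_{p∣m} a_{m/p}(f)`, by the `q`-expansion of `T_p`
(`qExpansion_coeff_heckeT_holds`, Diamond–Shurman Prop. 5.2.2(a); cf. Prop. 5.8.5). [cite: DiamondShurman2005, Prop. 5.2.2(a) and Prop. 5.8.5] -/
lemma heckeEigenvalue_mul_coeff {f : CuspForm (Gamma0 N) k} (hf : IsHeckeEigenform f) {p : ℕ}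
    (hp : p.Prime) (m : ℕ) :
    heckeEigenvalue f p * (qExpansion 1 ⇑f).coeff m =
      (qExpansion 1 ⇑f).coeff (p * m) +
        (if p ∣ N then 0 else (p : ℂ) ^ (k - 1) *
          (if p ∣ m then (qExpansion 1 ⇑f).coeff (m / p) else 0)) := by
  haveI : NeZero p := ⟨hp.ne_zero⟩
  rw [← qExpansion_coeff_heckeT_of_isHeckeEigenform hf hp m]
  exact qExpansion_coeff_heckeT_holds N k f p hp m

/-- **Coefficients are determined by the eigenvalues**: two normalised Hecke eigenforms on `Γ₀(N)`
(same `N`, `k`; eigenforms of all `T_p`) with `λ_p(f) = λ_p(g)` for all primes `p ∉ S` have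
`a_n(f) = a_n(g)` for every `n ≥ 1` with no prime factor in `S`: strong induction on `n`, using
the Hecke recursion `heckeEigenvalue_mul_coeff` at the least prime factor of `n`
(Diamond–Shurman §5.8: Prop. 5.8.5, proof of Thm. 5.8.2). [cite: DiamondShurman2005, Prop. 5.8.5] -/
theorem qExpansion_coeff_eq_of_heckeEigenvalue_eq
    {f g : CuspForm (Gamma0 N) k} (hf : IsHeckeEigenform f) (hg : IsHeckeEigenform g)
    (hf1 : IsNormalized f) (hg1 : IsNormalized g) (S : Finset ℕ)
    (hS : ∀ p : ℕ, p.Prime → p ∉ S → heckeEigenvalue f p = heckeEigenvalue g p) :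
    ∀ n : ℕ, n ≠ 0 → (∀ p ∈ S, ¬ p ∣ n) →
      (qExpansion 1 ⇑f).coeff n = (qExpansion 1 ⇑g).coeff n := by
  intro n
  induction n using Nat.strong_induction_on with
  | _ n ih =>
    intro hn0 hnS
    rcases eq_or_ne n 1 with rfl | hn1
    · exact hf1.trans hg1.symm
    set p := n.minFac with hp_def
    have hp : p.Prime := Nat.minFac_prime hn1
    have hpn : p ∣ n := Nat.minFac_dvd n
    obtain ⟨m, hm⟩ := hpn
    have hm0 : m ≠ 0 := by rintro rfl; simp at hm; exact hn0 hm
    have hmn : m < n := by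
      rw [hm]; exact lt_mul_left (Nat.pos_of_ne_zero hm0) hp.one_lt
    have hpS : p ∉ S := fun h ↦ hnS p h ⟨m, hm⟩
    -- divisors of `m` (and of `m / p`) are divisors of `n`
    have hmS : ∀ q ∈ S, ¬ q ∣ m := fun q hq hqm ↦ hnS q hq (hm ▸ dvd_mul_of_dvd_right hqm p)
    have hrec_f := heckeEigenvalue_mul_coeff hf hp m
    have hrec_g := heckeEigenvalue_mul_coeff hg hp m
    rw [← hm] at hrec_f hrec_g
    have hev : heckeEigenvalue f p = heckeEigenvalue g p := hS p hp hpS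
    have ham : (qExpansion 1 ⇑f).coeff m = (qExpansion 1 ⇑g).coeff m := ih m hmn hm0 hmS
    have hcorr : (if p ∣ m then (qExpansion 1 ⇑f).coeff (m / p) else 0) =
        (if p ∣ m then (qExpansion 1 ⇑g).coeff (m / p) else 0) := by
      split_ifs with hpm
      · obtain ⟨r, hr⟩ := hpm
        have hr0 : r ≠ 0 := by rintro rfl; simp at hr; exact hm0 hr
        have hrm : m / p = r := by rw [hr, Nat.mul_div_cancel_left _ hp.pos]
        rw [hrm]
        refine ih r ?_ hr0 fun q hq hqr ↦ hmS q hq (hr ▸ dvd_mul_of_dvd_right hqr p)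
        calc r ≤ m := by rw [hr]; exact Nat.le_mul_of_pos_left r hp.pos
          _ < n := hmn
      · rfl
    -- solve the two linear relations for `a_n`
    have ef : (qExpansion 1 ⇑f).coeff n = heckeEigenvalue f p * (qExpansion 1 ⇑f).coeff m -
        (if p ∣ N then 0 else (p : ℂ) ^ (k - 1) *
          (if p ∣ m then (qExpansion 1 ⇑f).coeff (m / p) else 0)) := by
      rw [hrec_f]; ring
    have eg : (qExpansion 1 ⇑g).coeff n = heckeEigenvalue g p * (qExpansion 1 ⇑g).coeff m -
        (if p ∣ N then 0 else (p : ℂ) ^ (k - 1) *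
          (if p ∣ m then (qExpansion 1 ⇑g).coeff (m / p) else 0)) := by
      rw [hrec_g]; ring
    rw [ef, eg, hev, ham, hcorr]

/-- For two normalised eigenforms with the same eigenvalues outside `S`, `a_n(f - g) = 0` for every
`n` with no prime factor in `S` (`n = 0` included: cusp forms). [folklore] -/
theorem qExpansion_coeff_sub_eq_zero_of_heckeEigenvalue_eq
    {f g : CuspForm (Gamma0 N) k} (hf : IsHeckeEigenform f) (hg : IsHeckeEigenform g)
    (hf1 : IsNormalized f) (hg1 : IsNormalized g) (S : Finset ℕ)
    (hS : ∀ p : ℕ, p.Prime → p ∉ S → heckeEigenvalue f p = heckeEigenvalue g p)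
    (n : ℕ) (hnS : ∀ p ∈ S, ¬ p ∣ n) :
    (qExpansion 1 ⇑(f - g)).coeff n = 0 := by
  rw [qExpansion_coeff_sub_level0, sub_eq_zero]
  rcases eq_or_ne n 0 with rfl | hn0
  · rw [CuspFormClass.qExpansion_coeff_zero f one_pos (one_mem_strictPeriods_gamma0 N),
      CuspFormClass.qExpansion_coeff_zero g one_pos (one_mem_strictPeriods_gamma0 N)]
  · exact qExpansion_coeff_eq_of_heckeEigenvalue_eq hf hg hf1 hg1 S hS n hn0 hnS

end Recursion

/-! ### Step 2: sieving out primes of the level and peeling off the other exceptional primes -/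

section Peel

variable {k : ℤ}

/-- **Peeling off primes not dividing the level.** If `S` is a finite set of primes not
dividing `L` and `f ∈ S_k(Γ₀(L))` has `a_n(f) = 0` for every `n` with no prime factor in `S`, then
`f = 0`: induction on `S` — the sieved form `K_p f` of level `L p²` satisfies the hypothesis for
`S ∖ {p}`, so vanishes, i.e. `a_n(f) = 0` for all `p ∤ n`, and the vanishing lemma
`eq_zero_of_coeff_eq_zero_of_not_dvd_level0_holds` applies. [folklore] -/
theorem eq_zero_of_coeff_eq_zero_off_primes (S : Finset ℕ) :
    ∀ (L : ℕ) [NeZero L] (f : CuspForm (Gamma0 L) k),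
      (∀ p ∈ S, p.Prime ∧ ¬ p ∣ L) →
      (∀ n : ℕ, (∀ p ∈ S, ¬ p ∣ n) → (qExpansion 1 ⇑f).coeff n = 0) → f = 0 := by
  induction S using Finset.induction_on with
  | empty =>
    intro L _ f _ hf
    exact eq_zero_of_qExpansion_coeff_eq_zero_level0 f fun n ↦ hf n (by simp)
  | insert p S hpS ih =>
    intro L _ f hS hf
    have hp : p.Prime := (hS p (Finset.mem_insert_self p S)).1
    have hpL : ¬ p ∣ L := (hS p (Finset.mem_insert_self p S)).2
    haveI : NeZero p := ⟨hp.ne_zero⟩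
    -- the sieved form at level `L p²`
    set w := sieveOp L k p f with hw
    have hw0 : w = 0 := by
      refine ih (L * p * p) w (fun q hqS ↦ ⟨(hS q (Finset.mem_insert_of_mem hqS)).1, ?_⟩) ?_
      · have hq := (hS q (Finset.mem_insert_of_mem hqS)).1
        have hqL := (hS q (Finset.mem_insert_of_mem hqS)).2
        have hqp : ¬ q ∣ p := by
          intro hqp'
          have := (Nat.prime_dvd_prime_iff_eq hq hp).mp hqp'
          exact hpS (this ▸ hqS)
        intro hdiv
        rcases (Nat.Prime.dvd_mul hq).mp hdiv with h1 | h1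
        · rcases (Nat.Prime.dvd_mul hq).mp h1 with h2 | h2
          · exact hqL h2
          · exact hqp h2
        · exact hqp h1
      · intro n hn
        rw [hw, qExpansion_coeff_sieveOp hp]
        split_ifs with hpn
        · rfl
        · exact hf n (by
            intro q hq
            rcases Finset.mem_insert.mp hq with rfl | hq'
            · exact hpn
            · exact hn q hq')
    -- hence `a_n(f) = 0` for all `n` prime to `p`, and the vanishing lemma applies
    refine eq_zero_of_coeff_eq_zero_of_not_dvd_level0_holds L k p hp hpL f fun n hpn ↦ ?_
    have := congrArg (fun F : CuspForm (Gamma0 (L * p * p)) k ↦ (qExpansion 1 ⇑F).coeff n) hw0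
    simp only [hw, qExpansion_coeff_sieveOp hp, if_neg hpn] at this
    simpa [CuspForm.coe_zero, qExpansion_zero] using this

/-- **Sieving out the primes dividing the level, then peeling.** If `B` is a finite set of primes dividing `L`, `G` a finite set of primes not dividing
`L`, and `f ∈ S_k(Γ₀(L))` has `a_n(f) = 0` for every `n` with no prime factor in `B ∪ G`, then
already `a_n(f) = 0` for every `n` with no prime factor in `B` (induction on `B` with the sieve
`K_p`, `p ∈ B`; the base case is `eq_zero_of_coeff_eq_zero_off_primes`). [folklore] -/
theorem coeff_eq_zero_off_primes_of_coeff_eq_zero_off_more_primes (B G : Finset ℕ) :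
    ∀ (L : ℕ) [NeZero L] (f : CuspForm (Gamma0 L) k),
      (∀ p ∈ B, p.Prime ∧ p ∣ L) → (∀ p ∈ G, p.Prime ∧ ¬ p ∣ L) →
      (∀ n : ℕ, (∀ p ∈ B, ¬ p ∣ n) → (∀ p ∈ G, ¬ p ∣ n) → (qExpansion 1 ⇑f).coeff n = 0) →
      ∀ n : ℕ, (∀ p ∈ B, ¬ p ∣ n) → (qExpansion 1 ⇑f).coeff n = 0 := by
  induction B using Finset.induction_on with
  | empty =>
    intro L _ f _ hG hf n _
    have := eq_zero_of_coeff_eq_zero_off_primes G L f hG (fun n hn ↦ hf n (by simp) hn)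
    rw [this]
    simp [CuspForm.coe_zero, qExpansion_zero]
  | insert p B hpB ih =>
    intro L _ f hB hG hf n hnB
    have hp : p.Prime := (hB p (Finset.mem_insert_self p B)).1
    have hpL : p ∣ L := (hB p (Finset.mem_insert_self p B)).2
    haveI : NeZero p := ⟨hp.ne_zero⟩
    have hpn : ¬ p ∣ n := hnB p (Finset.mem_insert_self p B)
    set w := sieveOp L k p f with hw
    -- `w` at level `L p²` satisfies the hypothesis with `B` in place of `insert p B`
    have key := ih (L * p * p) w
      (fun q hq ↦ ⟨(hB q (Finset.mem_insert_of_mem hq)).1,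
        ((hB q (Finset.mem_insert_of_mem hq)).2).trans ⟨p * p, by ring⟩⟩)
      (fun q hq ↦ ⟨(hG q hq).1, by
        have hq := (hG q hq).1
        have hqL := (hG q ‹q ∈ G›).2
        have hqp : ¬ q ∣ p := by
          intro hqp'
          have := (Nat.prime_dvd_prime_iff_eq hq hp).mp hqp'
          exact hqL (this ▸ hpL)
        intro hdiv
        rcases (Nat.Prime.dvd_mul hq).mp hdiv with h1 | h1
        · rcases (Nat.Prime.dvd_mul hq).mp h1 with h2 | h2
          · exact hqL h2
          · exact hqp h2
        · exact hqp h1⟩)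
      (by
        intro m hmB hmG
        rw [hw, qExpansion_coeff_sieveOp hp]
        split_ifs with hpm
        · rfl
        · exact hf m (by
            intro q hq
            rcases Finset.mem_insert.mp hq with rfl | hq'
            · exact hpm
            · exact hmB q hq') hmG)
      n (fun q hq ↦ hnB q (Finset.mem_insert_of_mem hq))
    rw [hw, qExpansion_coeff_sieveOp hp, if_neg hpn] at key
    exact key

end Peel

/-! ### Step 3: assembly -/

section Assembly

variable {N : ℕ} [NeZero N] {k : ℤ}

/-- **Strong multiplicity one on `Γ₀(N)`, reduced to two named facts.** Assuming
(ML) the Atkin–Lehner Main Lemma `atkinLehnerMainLemma0 N k` (Atkin–Lehner 1970, Thm. 1) and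
(D) `S_k(Γ₀(N))^{old} ∩ S_k(Γ₀(N))^{new} = 0` (`disjoint_oldSubspace0_newSubspace0`, Atkin–Lehner
1970, Thm. 5), two newforms of level `Γ₀(N)` with the same Hecke eigenvalues at all but finitely
many primes are equal (Atkin–Lehner 1970, Thm. 4, same-level case; the `q`-expansion of `T_p`,
Diamond–Shurman Prop. 5.2.2(a), enters through the theorem `qExpansion_coeff_heckeT_holds`, and the
level-raising vanishing lemma through `eq_zero_of_coeff_eq_zero_of_not_dvd_level0_holds`).
Proof: the coefficients of `h = f - g` vanish off the exceptional primes (Step 1), then off the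
primes dividing `N` (Step 2), so `h` is old by (ML); it is new, hence `0` by (D). [cite: AtkinLehner1970, Thm. 4] -/
theorem IsNewform0.eq_of_heckeEigenvalue_eq_of_facts
    (hML : atkinLehnerMainLemma0 N k) (hD : disjoint_oldSubspace0_newSubspace0 N k) :
    IsNewform0.eq_of_heckeEigenvalue_eq (N := N) (k := k) := by
  intro f g hf hg hfin
  -- exceptional primes `A`, primes of the level `B`, exceptional primes off the level `G`
  set A : Finset ℕ := hfin.toFinset with hA
  set B : Finset ℕ := N.primeFactors with hB
  set G : Finset ℕ := A.filter (fun p ↦ ¬ p ∣ N) with hG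
  have hS : ∀ p, p.Prime → p ∉ A ∪ B → heckeEigenvalue f p = heckeEigenvalue g p := by
    intro p hp hpAB
    by_contra hne
    exact hpAB (Finset.mem_union_left _ (hfin.mem_toFinset.mpr ⟨hp, hne⟩))
  -- (1) coefficients of `f - g` vanish off `A ∪ B`
  have h1 : ∀ n, (∀ p ∈ A ∪ B, ¬ p ∣ n) → (qExpansion 1 ⇑(f - g)).coeff n = 0 :=
    qExpansion_coeff_sub_eq_zero_of_heckeEigenvalue_eq hf.2.1 hg.2.1 hf.2.2 hg.2.2 (A ∪ B) hS
  -- (2) hence off `B` (sieve out `B`, peel `G`)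
  have h2 : ∀ n, (∀ p ∈ B, ¬ p ∣ n) → (qExpansion 1 ⇑(f - g)).coeff n = 0 := by
    refine coeff_eq_zero_off_primes_of_coeff_eq_zero_off_more_primes B G N (f - g) ?_ ?_ ?_
    · intro p hp
      exact ⟨Nat.prime_of_mem_primeFactors hp, Nat.dvd_of_mem_primeFactors hp⟩
    · intro p hp
      obtain ⟨hpA, hpN⟩ := Finset.mem_filter.mp hp
      exact ⟨(hfin.mem_toFinset.mp hpA).1, hpN⟩
    · intro n hnB hnG
      refine h1 n fun p hp ↦ ?_
      rcases Finset.mem_union.mp hp with hpA | hpB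
      · by_cases hpN : p ∣ N
        · exact hnB p (Nat.mem_primeFactors.mpr ⟨(hfin.mem_toFinset.mp hpA).1, hpN, NeZero.ne N⟩)
        · exact hnG p (Finset.mem_filter.mpr ⟨hpA, hpN⟩)
      · exact hnB p hpB
  -- (3) i.e. for all `n` prime to `N`
  have h3 : ∀ n : ℕ, n.Coprime N → (qExpansion 1 ⇑(f - g)).coeff n = 0 := by
    intro n hn
    refine h2 n fun p hp hpn ↦ ?_
    have hp' := Nat.prime_of_mem_primeFactors hp
    have : p ∣ Nat.gcd n N := Nat.dvd_gcd hpn (Nat.dvd_of_mem_primeFactors hp)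
    rw [hn] at this
    exact hp'.one_lt.ne' (Nat.dvd_one.mp this)
  -- (4) old (Main Lemma) and new, hence zero
  have hold : f - g ∈ oldSubspace0 N k := atkinLehnerMainLemma0.mem_oldSubspace0 N k hML _ h3
  have hnew : f - g ∈ newSubspace0 N k := Submodule.sub_mem _ hf.1 hg.1
  exact sub_eq_zero.mp ((Submodule.disjoint_def.mp hD) _ hold hnew)

end Assembly


end Literature.NumberTheory.EllipticCurves.ModularForms
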